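import Summits.Ventures.Crystal3D.Theorems.StickyWulffConstantCoaxialWallLawSeamVacancyCensus
import HarnessLib

/-!
# VACANCY CENSUS for an ABSTRACT dozen frame; the TWIN (anticuboctahedral) dozen as an instance
# (crux `CoaxialWallLaw`, stmt-Ventures-19481; lane F 'Certificates' v8.3, registered stub `stub_threePayer`)

HONEST FRAMING. Venture `Summits/Ventures/Crystal3D` (cell `crystal3d-full`); sequel of '…SeamVacancyCensus' (fcc slot dozen).  The same argument — the ¼-hole from
KissingGap (5/2) at three saturated neighbours of the vacancy (three unit spheres) + ONE cap-packing certificate per dozen — for an ABSTRACT DOZEN FRAME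
`e : Fin 12 → ℝ³` with neighbour table `nbr` (`IsDozenFrame`), instantiated on the TWIN DOZEN `twinSite` (composition normal `(1,1,1)/√3` of the cubic frame: six
in-plane slots, the lower slot triple, the three mirror images `(3s + 4·(1,1,1))/3` of the lower triple; cf. '…CoaxialWallLawTwinCage').  In the lane's certificate
universe (Barlow stackings with vacancies) every single-vacancy shell of an (A)-end ball is of one of the two kinds, so there `ThreePayer` needs exactly these rows.
* `IsDozenFrame`, **`DozenVacancyCap e nbr`** (named, certificate-shaped), **`two_unsaturated_of_dozenVacancy`**; `isDozenFrame_slot`, `dozenVacancyCap_slot_iff`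
  ('…SeamVacancyCensus' is the instance `e = slotSite`); `twinInt`/`twinSite`/`twinNbr` (tables by `decide`), `isDozenFrame_twin`,
  **`VacancyCapTwin := DozenVacancyCap twinSite twinNbr`**, **`two_unsaturated_of_twinVacancyShell`**.
NUMERICS (kit j335336 P2a, 19481-p2 g14): with the ¼-hole the eighth ball never fits — twin dozen minus an in-plane slot: margins 0.954 / 0.982 / 0.953 / 0.964
(four neighbour classes); minus a polar member: 0.978 / 0.978 / 0.951 / 0.964; 0/192 multistarts each.
WHAT THIS IS NOT: no cap certificate is proved; other composition normals are images of `twinSite` under sign changes of the cubic frame (not spelled out);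
exotic (non-dozen) shells untouched; F-C1 not moved.
-/

noncomputable section

namespace Summit.Ventures.Crystal3D.Theorems

namespace TailResidue

open Summit.Ventures.Crystal3D Finset NearIdentity
open scoped InnerProductSpace Matrix

variable {X : Finset (EuclideanSpace ℝ (Fin 3))}

/-! ### Abstract dozen frames -/
/-- **A dozen frame**: unit vectors `e k`; `nbr k` lists exactly the four `e l` at distance `1` (distinct, never `k`), any three independent; `e` injective. -/
structure IsDozenFrame (e : Fin 12 → EuclideanSpace ℝ (Fin 3)) (nbr : Fin 12 → Fin 4 → Fin 12) : Prop where
  norm_one : ∀ k, ‖e k‖ = 1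
  nbr_dist : ∀ k i, dist (e k) (e (nbr k i)) = 1
  nbr_complete : ∀ k l, dist (e k) (e l) = 1 → ∃ i, nbr k i = l
  nbr_inj : ∀ k i j, nbr k i = nbr k j → i = j
  nbr_ne : ∀ k i, nbr k i ≠ k
  indep : ∀ k (o i j l : Fin 4), o ≠ i → o ≠ j → o ≠ l → i ≠ j → i ≠ l → j ≠ l → LinearIndependent ℝ ![e (nbr k i), e (nbr k j), e (nbr k l)]
  inj : Function.Injective e

/-- **DOZEN VACANCY CAP (named input, certificate-shaped)** for `(e, nbr)`: for every isometry `A`, centre `b`, vacancy `k` and neighbour `q = nbr k i`, a finite set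
of balls touching `b + A(e q)`, none at a dozen position, all `≥ 1` from `b` and from the dozen balls `b + A(e l)` (`l ≠ k`), all `≥ 1/4` from the vacant position
`b + A(e k)`, pairwise `≥ 1` apart, has at most SEVEN members. -/
def DozenVacancyCap (e : Fin 12 → EuclideanSpace ℝ (Fin 3)) (nbr : Fin 12 → Fin 4 → Fin 12) : Prop :=
  ∀ (A : EuclideanSpace ℝ (Fin 3) ≃ₗᵢ[ℝ] EuclideanSpace ℝ (Fin 3)) (b : EuclideanSpace ℝ (Fin 3)) (k : Fin 12) (i : Fin 4)
    (N : Finset (EuclideanSpace ℝ (Fin 3))),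
    (∀ x ∈ N, dist x (b + A (e (nbr k i))) = 1) →
    (∀ x ∈ N, ∀ l : Fin 12, x ≠ b + A (e l)) →
    (∀ x ∈ N, 1 ≤ dist x b) →
    (∀ x ∈ N, ∀ l : Fin 12, l ≠ k → 1 ≤ dist x (b + A (e l))) →
    (∀ x ∈ N, 1 / 4 ≤ dist x (b + A (e k))) →
    (∀ x ∈ N, ∀ y ∈ N, x ≠ y → 1 ≤ dist x y) →
    N.card ≤ 7

section Abstract
variable {e : Fin 12 → EuclideanSpace ℝ (Fin 3)} {nbr : Fin 12 → Fin 4 → Fin 12}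

/-- The dozen ball `b + A(e k)` is at distance `1` from `b`. -/
theorem dist_dozenBall_center (hF : IsDozenFrame e nbr) (A : EuclideanSpace ℝ (Fin 3) ≃ₗᵢ[ℝ] EuclideanSpace ℝ (Fin 3)) (b : EuclideanSpace ℝ (Fin 3)) (k : Fin 12) :
    dist b (b + A (e k)) = 1 := by
  rw [dist_comm, dist_eq_norm, add_sub_cancel_left, LinearIsometryEquiv.norm_map, hF.norm_one k]

/-- Distances between dozen balls are those of the frame. -/
theorem dist_dozenBall (A : EuclideanSpace ℝ (Fin 3) ≃ₗᵢ[ℝ] EuclideanSpace ℝ (Fin 3)) (b : EuclideanSpace ℝ (Fin 3)) (k l : Fin 12) :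
    dist (b + A (e k)) (b + A (e l)) = dist (e k) (e l) := by
  rw [dist_add_map, ← dist_eq_norm]

/-- A neighbour `q = nbr k i` of `k` has exactly three listed neighbours other than `k`. -/
theorem card_nbr_other (hF : IsDozenFrame e nbr) (k : Fin 12) (i : Fin 4) :
    (univ.filter fun l : Fin 12 => l ≠ k ∧ dist (e (nbr k i)) (e l) = 1).card = 3 := by
  classical
  set q := nbr k i with hq
  have hset : (univ.filter fun l : Fin 12 => l ≠ k ∧ dist (e q) (e l) = 1) = (univ.image (nbr q)).erase k := by
    ext l
    simp only [mem_filter, mem_univ, true_and, mem_erase, mem_image]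
    constructor
    · rintro ⟨hlk, hd⟩
      obtain ⟨j, hj⟩ := hF.nbr_complete q l hd
      exact ⟨hlk, j, hj⟩
    · rintro ⟨hlk, j, hj⟩
      exact ⟨hlk, by rw [← hj]; exact hF.nbr_dist q j⟩
  have hkmem : k ∈ univ.image (nbr q) := by
    have hd : dist (e q) (e k) = 1 := by rw [dist_comm, hq]; exact hF.nbr_dist k i
    obtain ⟨j, hj⟩ := hF.nbr_complete q k hd
    exact mem_image.2 ⟨j, mem_univ _, hj⟩
  rw [hset, card_erase_of_mem hkmem, card_image_of_injective _ (fun a c h => hF.nbr_inj q a c h)]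
  simp

open scoped Classical in
/-- **THE ¼-HOLE (abstract frame).**  Under GAP(5/2): if the dozen ball at the vacancy `b + A(e k)` is absent and three distinct neighbours of the vacancy are saturated,
then every ball of `X` is at distance `≥ 1/4` from the vacant position. -/
theorem quarter_le_dist_dozenVacancy (hg : KissingGap (5 / 2)) (hF : IsDozenFrame e nbr) (hX : ∀ p ∈ X, ∀ q ∈ X, p ≠ q → 1 ≤ dist p q)
    (A : EuclideanSpace ℝ (Fin 3) ≃ₗᵢ[ℝ] EuclideanSpace ℝ (Fin 3)) (b : EuclideanSpace ℝ (Fin 3)) {k : Fin 12}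
    (hvac : b + A (e k) ∉ X) {i j l : Fin 4} (hij : i ≠ j) (hil : i ≠ l) (hjl : j ≠ l) (ho : ∃ o : Fin 4, o ≠ i ∧ o ≠ j ∧ o ≠ l)
    (hsat : ∀ m ∈ ({i, j, l} : Finset (Fin 4)), b + A (e (nbr k m)) ∈ X ∧ (X.filter fun q => dist (b + A (e (nbr k m))) q = 1).card = 12)
    {x : EuclideanSpace ℝ (Fin 3)} (hx : x ∈ X) : 1 / 4 ≤ dist x (b + A (e k)) := by
  by_contra hlt
  push Not at hlt
  have hone : ∀ m ∈ ({i, j, l} : Finset (Fin 4)), dist (b + A (e (nbr k m))) x = 1 := by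
    intro m hm
    obtain ⟨hmX, h12⟩ := hsat m hm
    have hadj : dist (b + A (e k)) (b + A (e (nbr k m))) = 1 := by rw [dist_dozenBall]; exact hF.nbr_dist k m
    rcases eq_or_dist_eq_one_or_le_dist_of_saturated hg hX hmX h12 hx with h | h | h
    · rw [h, dist_comm] at hlt; rw [hadj] at hlt; norm_num at hlt
    · exact h
    · have htri := dist_triangle (b + A (e (nbr k m))) (b + A (e k)) x
      rw [dist_comm (b + A (e (nbr k m))) (b + A (e k)), hadj] at htri
      rw [dist_comm] at hlt
      linarith
  obtain ⟨o, hoi, hoj, hol⟩ := ho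
  let idx : Fin 3 → Fin 4 := ![i, j, l]
  have hidx : ∀ m, idx m ∈ ({i, j, l} : Finset (Fin 4)) := by intro m; fin_cases m <;> simp [idx]
  let w : Fin 3 → EuclideanSpace ℝ (Fin 3) := fun m => A (e (nbr k (idx m)))
  have hind0 : LinearIndependent ℝ ![e (nbr k i), e (nbr k j), e (nbr k l)] := hF.indep k o i j l hoi hoj hol hij hil hjl
  have hind : LinearIndependent ℝ w := by
    have h := hind0.map' A.toLinearEquiv.toLinearMap (LinearMap.ker_eq_bot.2 A.toLinearEquiv.injective)
    have eq : w = (A.toLinearEquiv.toLinearMap : EuclideanSpace ℝ (Fin 3) →ₗ[ℝ] EuclideanSpace ℝ (Fin 3)) ∘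
        ![e (nbr k i), e (nbr k j), e (nbr k l)] := by
      funext m; fin_cases m <;> rfl
    rw [eq]; exact h
  have hwn : ∀ m, ‖w m‖ = 1 := fun m => by
    show ‖A (e (nbr k (idx m)))‖ = 1
    rw [LinearIsometryEquiv.norm_map, hF.norm_one]
  have hs0 : ‖A (e k)‖ = 1 := by rw [LinearIsometryEquiv.norm_map, hF.norm_one]
  have hsw : ∀ m, ⟪A (e k), w m⟫_ℝ = 1 / 2 := fun m => by
    show ⟪A (e k), A (e (nbr k (idx m)))⟫_ℝ = 1 / 2
    rw [LinearIsometryEquiv.inner_map_map]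
    have hd := hF.nbr_dist k (idx m)
    rw [dist_eq_norm] at hd
    have h2 : ‖e k - e (nbr k (idx m))‖ ^ 2 = 1 := by rw [hd, one_pow]
    rw [← real_inner_self_eq_norm_sq, inner_sub_left, inner_sub_right, inner_sub_right, real_inner_self_eq_norm_sq, real_inner_self_eq_norm_sq, hF.norm_one,
      hF.norm_one, real_inner_comm (e k) (e (nbr k (idx m)))] at h2
    linarith
  have hxw : ∀ m, dist (x - b) (w m) = 1 := fun m => by
    show dist (x - b) (A (e (nbr k (idx m)))) = 1
    have eq : ∀ v : EuclideanSpace ℝ (Fin 3), dist (x - b) v = dist (b + v) x := fun v => by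
      rw [dist_eq_norm, dist_eq_norm, ← norm_neg (b + v - x)]; congr 1; abel
    rw [eq]; exact hone (idx m) (hidx m)
  rcases eq_zero_or_eq_of_dist_eq_one_three hind hwn hs0 hsw hxw with h0 | h1
  · have hxb : x = b := by rwa [sub_eq_zero] at h0
    rw [hxb, dist_dozenBall_center hF] at hlt; norm_num at hlt
  · have hxv : x = b + A (e k) := by rw [← h1]; abel
    exact hvac (hxv ▸ hx)

open scoped Classical in
/-- **VACANCY CENSUS (abstract frame).**  Under GAP(5/2), for a dozen frame `(e, nbr)` with `DozenVacancyCap e nbr`: if the eleven dozen balls `b + A(e l)`, `l ≠ k`,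
of a ball `b ∈ X` are present and `b + A(e k)` is absent, then two distinct neighbours of `b` have at most eleven contacts each. -/
theorem two_unsaturated_of_dozenVacancy (hg : KissingGap (5 / 2)) (hF : IsDozenFrame e nbr) (hcap : DozenVacancyCap e nbr)
    (hX : ∀ p ∈ X, ∀ q ∈ X, p ≠ q → 1 ≤ dist p q) (A : EuclideanSpace ℝ (Fin 3) ≃ₗᵢ[ℝ] EuclideanSpace ℝ (Fin 3)) {b : EuclideanSpace ℝ (Fin 3)} (hb : b ∈ X)
    {k : Fin 12} (hocc : ∀ l : Fin 12, l ≠ k → b + A (e l) ∈ X) (hvac : b + A (e k) ∉ X) :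
    ∃ y ∈ X, ∃ y' ∈ X, y ≠ y' ∧ dist b y = 1 ∧ dist b y' = 1 ∧
      (X.filter fun q => dist y q = 1).card ≤ 11 ∧ (X.filter fun q => dist y' q = 1).card ≤ 11 := by
  set n : Fin 4 → EuclideanSpace ℝ (Fin 3) := fun i => b + A (e (nbr k i)) with hn
  have hnX : ∀ i, n i ∈ X := fun i => hocc _ (hF.nbr_ne k i)
  have hnb : ∀ i, dist b (n i) = 1 := fun i => dist_dozenBall_center hF A b _
  have hninj : ∀ i j, n i = n j → i = j := by
    intro i j h
    exact hF.nbr_inj k i j (hF.inj (A.injective (add_left_cancel h)))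
  have hle : ∀ i, (X.filter fun q => dist (n i) q = 1).card ≤ 12 := fun i => card_filter_dist_eq_one_le_twelve X hX _
  by_contra H
  push Not at H
  have huniq : ∀ i j, (X.filter fun q => dist (n i) q = 1).card ≤ 11 → (X.filter fun q => dist (n j) q = 1).card ≤ 11 → i = j := by
    intro i j hi hj
    by_contra hij
    have hne : n i ≠ n j := fun h => hij (hninj i j h)
    have := H (n i) (hnX i) (n j) (hnX j) hne (hnb i) (hnb j) hi
    omega
  obtain ⟨o, ho⟩ : ∃ o : Fin 4, ∀ m, m ≠ o → (X.filter fun q => dist (n m) q = 1).card = 12 := by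
    by_cases hex : ∃ o : Fin 4, (X.filter fun q => dist (n o) q = 1).card ≤ 11
    · obtain ⟨o, ho⟩ := hex
      refine ⟨o, fun m hm => ?_⟩
      have h1 := hle m
      by_contra hne
      exact hm (huniq m o (by omega) ho)
    · push Not at hex
      exact ⟨0, fun m _ => le_antisymm (hle m) (by have := hex m; omega)⟩
  set i := o.succAbove 0 with hi
  set j := o.succAbove 1 with hj
  set l := o.succAbove 2 with hl
  have hij : i ≠ j := fun h => by have := Fin.succAbove_right_injective (p := o) h; exact absurd this (by decide)
  have hil : i ≠ l := fun h => by have := Fin.succAbove_right_injective (p := o) h; exact absurd this (by decide)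
  have hjl : j ≠ l := fun h => by have := Fin.succAbove_right_injective (p := o) h; exact absurd this (by decide)
  have hoi : o ≠ i := (Fin.succAbove_ne o 0).symm
  have hoj : o ≠ j := (Fin.succAbove_ne o 1).symm
  have hol : o ≠ l := (Fin.succAbove_ne o 2).symm
  have hsat : ∀ m ∈ ({i, j, l} : Finset (Fin 4)), b + A (e (nbr k m)) ∈ X ∧ (X.filter fun q => dist (b + A (e (nbr k m))) q = 1).card = 12 := by
    intro m hm
    simp only [mem_insert, mem_singleton] at hm
    refine ⟨hnX m, ho m ?_⟩
    rcases hm with rfl | rfl | rfl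
    · exact hoi.symm
    · exact hoj.symm
    · exact hol.symm
  have hole : ∀ x ∈ X, 1 / 4 ≤ dist x (b + A (e k)) := fun x hx =>
    quarter_le_dist_dozenVacancy hg hF hX A b hvac hij hil hjl ⟨o, hoi, hoj, hol⟩ hsat hx
  have hi12 : (X.filter fun q => dist (n i) q = 1).card = 12 := ho i hoi.symm
  set C := X.filter fun q => dist (n i) q = 1 with hC
  set Fp : Finset (EuclideanSpace ℝ (Fin 3)) :=
    insert b ((univ.filter fun m : Fin 12 => m ≠ k ∧ dist (e (nbr k i)) (e m) = 1).image fun m => b + A (e m)) with hFp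
  have hball_inj : Function.Injective fun m : Fin 12 => b + A (e m) := fun m m' h => hF.inj (A.injective (add_left_cancel h))
  have hb_notin : b ∉ (univ.filter fun m : Fin 12 => m ≠ k ∧ dist (e (nbr k i)) (e m) = 1).image fun m => b + A (e m) := by
    intro hmem
    obtain ⟨m, -, hm⟩ := mem_image.1 hmem
    have h1 := dist_dozenBall_center hF A b m
    rw [hm, dist_self] at h1
    exact zero_ne_one h1
  have hFcard : Fp.card = 4 := by
    rw [hFp, card_insert_of_notMem hb_notin, card_image_of_injective _ hball_inj, card_nbr_other hF k i]
  have hFsub : Fp ⊆ C := by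
    intro x hx
    rw [hFp, mem_insert] at hx
    rcases hx with rfl | hx
    · exact mem_filter.2 ⟨hb, by rw [dist_comm]; exact hnb i⟩
    · obtain ⟨m, hm, rfl⟩ := mem_image.1 hx
      obtain ⟨hmk, hd⟩ := (mem_filter.1 hm).2
      exact mem_filter.2 ⟨hocc m hmk, by rw [hn]; simp only; rw [dist_dozenBall]; exact hd⟩
  set N := C \ Fp with hN
  have hNcard : N.card = 8 := by rw [hN, card_sdiff_of_subset hFsub, hi12, hFcard]
  have hNsub : ∀ x ∈ N, x ∈ X ∧ dist (n i) x = 1 ∧ x ∉ Fp := fun x hx => by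
    obtain ⟨hxC, hxF⟩ := mem_sdiff.1 hx
    exact ⟨(mem_filter.1 hxC).1, (mem_filter.1 hxC).2, hxF⟩
  have h1 : ∀ x ∈ N, dist x (b + A (e (nbr k i))) = 1 := fun x hx => by rw [dist_comm]; exact (hNsub x hx).2.1
  have h2 : ∀ x ∈ N, ∀ m : Fin 12, x ≠ b + A (e m) := by
    intro x hx m hxm
    obtain ⟨hxX, hxd, hxF⟩ := hNsub x hx
    by_cases hmk : m = k
    · rw [hmk] at hxm; exact hvac (hxm ▸ hxX)
    · have hd : dist (e (nbr k i)) (e m) = 1 := by rw [← dist_dozenBall A b]; rw [hn] at hxd; simpa [hxm] using hxd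
      apply hxF
      rw [hFp, mem_insert]
      exact Or.inr (mem_image.2 ⟨m, mem_filter.2 ⟨mem_univ _, hmk, hd⟩, hxm.symm⟩)
  have h3 : ∀ x ∈ N, 1 ≤ dist x b := by
    intro x hx
    obtain ⟨hxX, -, hxF⟩ := hNsub x hx
    have hxb : x ≠ b := fun h => hxF (by rw [hFp, h]; exact mem_insert_self _ _)
    exact hX x hxX b hb hxb
  have h4 : ∀ x ∈ N, ∀ m : Fin 12, m ≠ k → 1 ≤ dist x (b + A (e m)) := fun x hx m hmk =>
    hX x (hNsub x hx).1 _ (hocc m hmk) (h2 x hx m)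
  have h5 : ∀ x ∈ N, 1 / 4 ≤ dist x (b + A (e k)) := fun x hx => hole x (hNsub x hx).1
  have h6 : ∀ x ∈ N, ∀ y ∈ N, x ≠ y → 1 ≤ dist x y := fun x hx y hy hxy => hX x (hNsub x hx).1 y (hNsub y hy).1 hxy
  have h7 := hcap A b k i N h1 h2 h3 h4 h5 h6
  omega

end Abstract
/-! ### The slot dozen is a dozen frame (so '…SeamVacancyCensus' is the instance `e = slotSite`) -/

/-- The cuboctahedral slot dozen with its neighbour table is a dozen frame. -/
theorem isDozenFrame_slot : IsDozenFrame slotSite slotNbr where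
  norm_one k := norm_eq_one_of_mem_fccSlots (slotSite_mem k)
  nbr_dist k i := by
    have h := (dist_slotBall_eq_one_iff (LinearIsometryEquiv.refl ℝ _) 0 k (slotNbr k i)).2 (slotNbr_spec.1 k i)
    simpa using h
  nbr_complete k l h := by
    have h' : slotInt k ⬝ᵥ slotInt l = 1 := (dist_slotBall_eq_one_iff (LinearIsometryEquiv.refl ℝ _) 0 k l).1 (by simpa using h)
    exact slotNbr_spec.2.2 k l h'
  nbr_inj := slotNbr_spec.2.1
  nbr_ne := slotNbr_ne_self
  indep k o i j l hoi hoj hol hij hil hjl := linearIndependent_slotSite (slotNbr_det k o i j l hoi hoj hol hij hil hjl)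
  inj := slotSite_injective

/-- The abstract cap statement for the slot dozen is `VacancyCapFcc`. -/
theorem dozenVacancyCap_slot_iff : DozenVacancyCap slotSite slotNbr ↔ VacancyCapFcc := Iff.rfl
/-! ### The twin (anticuboctahedral) dozen -/
/-- Integer table (cubic coordinates × 3√2... i.e. scaled by `3` relative to `slotInt`) of the TWIN DOZEN with composition normal `(1,1,1)/√3`: six in-plane slots
(`Σ = 0`), the lower slot triple (`Σ = −6`), and the three mirror images `3s + 4·(1,1,1)` of the lower triple (`Σ = +6`). -/
def twinInt : Fin 12 → Fin 3 → ℤ :=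
  ![![3, -3, 0], ![-3, 3, 0], ![3, 0, -3], ![-3, 0, 3], ![0, 3, -3], ![0, -3, 3], ![-3, -3, 0], ![-3, 0, -3], ![0, -3, -3], ![1, 1, 4], ![1, 4, 1], ![4, 1, 1]]

/-- The four twin-dozen neighbours (`twinInt k ⬝ twinInt l = 9`) of each member. -/
def twinNbr : Fin 12 → Fin 4 → Fin 12 :=
  ![![2, 5, 8, 11], ![3, 4, 7, 10], ![0, 4, 8, 11], ![1, 5, 6, 9], ![1, 2, 7, 10], ![0, 3, 6, 9], ![3, 5, 7, 8], ![1, 4, 6, 8], ![0, 2, 6, 7],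
    ![3, 5, 10, 11], ![1, 4, 9, 11], ![0, 2, 9, 10]]

/-- Table checks (kernel decision): norms `18`, neighbours at `9`, distinct, complete, never self, independent triples, injective. -/
theorem twin_tables :
    (∀ k : Fin 12, twinInt k ⬝ᵥ twinInt k = 18) ∧
    (∀ k : Fin 12, ∀ i : Fin 4, twinInt k ⬝ᵥ twinInt (twinNbr k i) = 9) ∧
    (∀ k : Fin 12, ∀ i j : Fin 4, twinNbr k i = twinNbr k j → i = j) ∧
    (∀ k l : Fin 12, twinInt k ⬝ᵥ twinInt l = 9 → ∃ i : Fin 4, twinNbr k i = l) ∧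
    (∀ k : Fin 12, ∀ i : Fin 4, twinNbr k i ≠ k) ∧
    (∀ k : Fin 12, ∀ o i j l : Fin 4, o ≠ i → o ≠ j → o ≠ l → i ≠ j → i ≠ l → j ≠ l →
      twinInt (twinNbr k i) ⬝ᵥ crossInt (twinInt (twinNbr k j)) (twinInt (twinNbr k l)) ≠ 0) ∧
    (∀ k l : Fin 12, twinInt k = twinInt l → k = l) := by
  refine ⟨by decide, by decide, by decide, by decide, by decide, by decide, by decide⟩

/-- **The twin dozen** as vectors of `ℝ³`: `twinSite k = Σᵢ (twinInt k i / (3√2)) • cubicFrame i`. -/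
def twinSite (k : Fin 12) : EuclideanSpace ℝ (Fin 3) :=
  ∑ i : Fin 3, ((twinInt k i : ℝ) / (3 * Real.sqrt 2)) • cubicFrame i

/-- Cubic coordinates of the twin dozen. -/
theorem cubicCoords_twinSite (k : Fin 12) : cubicCoords (twinSite k) = fun i => (twinInt k i : ℝ) / (3 * Real.sqrt 2) := by
  rw [twinSite, Fin.sum_univ_three, cubicCoords_add, cubicCoords_add, cubicCoords_smul, cubicCoords_smul, cubicCoords_smul, cubicCoords_cubicFrame,
    cubicCoords_cubicFrame, cubicCoords_cubicFrame]
  ext i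
  fin_cases i <;> simp

/-- `⟪twinSite k, twinSite l⟫ = (twinInt k ⬝ twinInt l) / 18`. -/
theorem inner_twinSite (k l : Fin 12) : ⟪twinSite k, twinSite l⟫_ℝ = ((twinInt k ⬝ᵥ twinInt l : ℤ) : ℝ) / 18 := by
  rw [inner_eq_cubicCoords, cubicCoords_twinSite, cubicCoords_twinSite]
  simp only [dotProduct, Fin.sum_univ_three]
  have hs : Real.sqrt 2 ^ 2 = 2 := Real.sq_sqrt (by norm_num)
  push_cast
  field_simp
  rw [hs]; ring

/-- The twin dozen consists of unit vectors. -/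
theorem norm_twinSite (k : Fin 12) : ‖twinSite k‖ = 1 := by
  have h : ‖twinSite k‖ ^ 2 = 1 := by
    rw [← real_inner_self_eq_norm_sq, inner_twinSite, twin_tables.1 k]; norm_num
  nlinarith [norm_nonneg (twinSite k)]

/-- `dist (twinSite k) (twinSite l) = 1 ↔ twinInt k ⬝ twinInt l = 9`. -/
theorem dist_twinSite_eq_one_iff (k l : Fin 12) : dist (twinSite k) (twinSite l) = 1 ↔ twinInt k ⬝ᵥ twinInt l = 9 := by
  have h : dist (twinSite k) (twinSite l) ^ 2 = 2 - ((twinInt k ⬝ᵥ twinInt l : ℤ) : ℝ) / 9 := by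
    rw [dist_eq_norm, ← real_inner_self_eq_norm_sq, inner_sub_left, inner_sub_right, inner_sub_right, inner_twinSite, inner_twinSite, inner_twinSite,
      inner_twinSite, twin_tables.1 k, twin_tables.1 l, show twinInt l ⬝ᵥ twinInt k = twinInt k ⬝ᵥ twinInt l from dotProduct_comm _ _]
    push_cast; ring
  have h0 : 0 ≤ dist (twinSite k) (twinSite l) := dist_nonneg
  constructor
  · intro h1
    rw [h1, one_pow] at h
    have : ((twinInt k ⬝ᵥ twinInt l : ℤ) : ℝ) = 9 := by linarith
    exact_mod_cast this
  · intro h1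
    rw [h1] at h
    push_cast at h
    nlinarith

/-- A non-zero integer triple product makes three twin-dozen members linearly independent (cubic-coordinate version of `linearIndependent_slotSite`). -/
theorem linearIndependent_twinSite {i j k : Fin 12} (h : twinInt i ⬝ᵥ crossInt (twinInt j) (twinInt k) ≠ 0) :
    LinearIndependent ℝ ![twinSite i, twinSite j, twinSite k] := by
  classical
  rw [Fintype.linearIndependent_iff]
  intro g hg
  set M : Matrix (Fin 3) (Fin 3) ℝ := Matrix.of fun r c => (twinInt (![i, j, k] r) c : ℝ) with hM
  have hdet : M.det ≠ 0 := by
    have e : M.det = ((twinInt i ⬝ᵥ crossInt (twinInt j) (twinInt k) : ℤ) : ℝ) := by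
      rw [Matrix.det_fin_three]
      simp [hM, crossInt, dotProduct, Fin.sum_univ_three]
      ring
    rw [e]; exact_mod_cast h
  have hvec : g ᵥ* M = 0 := by
    have hc := congrArg cubicCoords hg
    simp only [Fin.sum_univ_three, Matrix.cons_val_zero, Matrix.cons_val_one, Matrix.cons_val, cubicCoords_add, cubicCoords_smul, cubicCoords_twinSite] at hc
    have hc0 : cubicCoords (0 : EuclideanSpace ℝ (Fin 3)) = 0 := by
      have := cubicCoords_smul 0 (0 : EuclideanSpace ℝ (Fin 3))
      rwa [zero_smul, zero_smul] at this
    rw [hc0] at hc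
    ext c
    have hcc := congrFun hc c
    simp only [Pi.add_apply, Pi.smul_apply, smul_eq_mul, Pi.zero_apply] at hcc
    simp only [Matrix.vecMul, dotProduct, Fin.sum_univ_three, hM, Matrix.of_apply, Matrix.cons_val_zero, Matrix.cons_val_one, Matrix.cons_val, Pi.zero_apply]
    have hs : (3 : ℝ) * Real.sqrt 2 ≠ 0 := by positivity
    field_simp at hcc
    linarith
  have := Matrix.eq_zero_of_vecMul_eq_zero hdet hvec
  intro r
  exact congrFun this r

/-- **The twin dozen is a dozen frame.** -/
theorem isDozenFrame_twin : IsDozenFrame twinSite twinNbr where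
  norm_one := norm_twinSite
  nbr_dist k i := (dist_twinSite_eq_one_iff k (twinNbr k i)).2 (twin_tables.2.1 k i)
  nbr_complete k l h := twin_tables.2.2.2.1 k l ((dist_twinSite_eq_one_iff k l).1 h)
  nbr_inj := twin_tables.2.2.1
  nbr_ne := twin_tables.2.2.2.2.1
  indep k o i j l hoi hoj hol hij hil hjl := linearIndependent_twinSite (twin_tables.2.2.2.2.2.1 k o i j l hoi hoj hol hij hil hjl)
  inj k l h := by
    apply twin_tables.2.2.2.2.2.2 k l
    have hc := congrArg cubicCoords h
    rw [cubicCoords_twinSite, cubicCoords_twinSite] at hc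
    funext c
    have hcc := congrFun hc c
    have hs : (3 : ℝ) * Real.sqrt 2 ≠ 0 := by positivity
    have : ((twinInt k c : ℤ) : ℝ) = twinInt l c := by simpa [div_left_inj' hs] using hcc
    exact_mod_cast this

/-- **TWIN VACANCY CAP (named input, certificate-shaped)**: the rows of `DozenVacancyCap` for the twin dozen (kit j335336 P2a: margins 0.950–0.982). -/
def VacancyCapTwin : Prop := DozenVacancyCap twinSite twinNbr

open scoped Classical in
/-- **VACANCY CENSUS (twin type).**  Under GAP(5/2) and `VacancyCapTwin`: if eleven of the twelve balls `b + A(twinSite l)` of the twin dozen of `b ∈ X` are present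
and the twelfth is absent, two distinct neighbours of `b` have at most eleven contacts. -/
theorem two_unsaturated_of_twinVacancyShell (hg : KissingGap (5 / 2)) (hcap : VacancyCapTwin) (hX : ∀ p ∈ X, ∀ q ∈ X, p ≠ q → 1 ≤ dist p q)
    (A : EuclideanSpace ℝ (Fin 3) ≃ₗᵢ[ℝ] EuclideanSpace ℝ (Fin 3)) {b : EuclideanSpace ℝ (Fin 3)} (hb : b ∈ X) {k : Fin 12}
    (hocc : ∀ l : Fin 12, l ≠ k → b + A (twinSite l) ∈ X) (hvac : b + A (twinSite k) ∉ X) :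
    ∃ y ∈ X, ∃ y' ∈ X, y ≠ y' ∧ dist b y = 1 ∧ dist b y' = 1 ∧
      (X.filter fun q => dist y q = 1).card ≤ 11 ∧ (X.filter fun q => dist y' q = 1).card ≤ 11 :=
  two_unsaturated_of_dozenVacancy hg isDozenFrame_twin hcap hX A hb hocc hvac

end TailResidue

end Summit.Ventures.Crystal3D.Theorems

end
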